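import Summits.HodgeConjecture.CorCM.MultiFieldWeilTwinUnitsKind
import Mathlib.LinearAlgebra.LinearIndependent.Defs
import HarnessLib

/-!
# MULTI-FIELD WEIL ENGINE — UNIT SEPARATION: the signed equations of a closed `2`-TRANSITIVE set of permutations read through SEVERAL position sets at once
# (several CM types of ONE field) force every defect to be constant as soon as the CENTRED INDICATORS of the position sets are linearly independent (census level)

Cell `pub-hodgecm2` (COR-CM), seat b30 gen 39 (2026-08-25); count-neutral own lane MULTI-FIELD WEIL ENGINE (stem `MultiFieldWeil*`), census level (abstract sets of
permutations), the common generalisation of gen 37's twin unit (`CorCM/MultiFieldWeilTwinUnits.lean` §2 `const_of_signed_twin`: TWO slots with SINGLETON position sets)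
and of the homogeneous single slot (`CorCM/MultiFieldWeilSlotwiseSeparation.lean` `sep_of_homogeneous`).  Theorems only; no definition, no named fact, no `sorry`, no `decide`.
HONEST FRAMING: pure finite combinatorics; `HC_CM` is NOT touched.

THE POINT.  A UNIT is a set of slots reading ONE frame (several CM types `Φ_i` of ONE field): every realised tuple is diagonal on it, so the signed equations only say that
`Σ_i E_i(σ)` is constant for `σ` in the common image `H ≤ Sym(k)`, where `E_i(σ) = Σ_a ±_{σ a ∈ Q_i} u_i(a)` is the signed sum of the defect `u_i` through the position set
`Q_i`.  WHEN DOES THIS FORCE EVERY `u_i` TO BE CONSTANT?  Here, for `H` closed under products and `2`-TRANSITIVE: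
* §1 **pair fibres** (`card_filter_pair_eq`): the sets `{σ ∈ H : σ p = x, σ p' = y}` (`p ≠ p'`, `x ≠ y`) all have the same size `N > 0` (two-sided translation), so
  (`sum_filter_apply_eq_of_twoTransitive`) for `a ≠ b` the values `σ a`, `σ ∈ H`, `σ b = q₀`, run `N` times through every `y ≠ q₀`;
* §2 **the cell identity** (`sum_cells_mul_eq_of_twoTransitive`): summing the signed equations over `{σ ∈ H : σ b = q₀}` gives, for every letter `q₀`,
  `Σ_i (k·[q₀ ∈ Q_i] − |Q_i|)·u_i(b)` INDEPENDENT of `b` — one linear relation per cell of the Venn diagram of the `Q_i`;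
* §3 **separation** (`const_of_cells_of_linearIndependent`, `const_of_signed_unit_of_linearIndependent`): if the centred indicators `k·𝟙_{Q_i} − |Q_i|·𝟙` (`i ∈ ι`) are
  LINEARLY INDEPENDENT over `ℚ`, every `u_i` is constant; in particular (§4) ONE proper non-empty position set of ANY size (`const_of_signed_of_twoTransitive`), and TWO
  proper non-empty position sets `Q₂ ∉ {Q₁, Q₁ᶜ}` of any sizes (`linearIndependent_cells_of_two`, `const_of_signed_pair_of_twoTransitive`) — the twin unit with ARBITRARY
  position sets: `(2,2)`-twins and `(1,3)+(2,2)` twins over one `𝔄₄`/`𝔖₄`-octic field, `(2,3)`-twins over one decic field with `2`-transitive quintic part.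
The criterion is sharp for the method: a dependency `Σ_i g_i (k·𝟙_{Q_i} − |Q_i|) = 0` is a non-constant solution (`u_i = g_i·𝟙_{b₀}`-type configurations are not needed
here and not discussed).  Sequel: the defect law for tuple sets with units of any size (`CorCM/MultiFieldWeilUnitsDefectLaw.lean`), its realised reading, and the menu with
SEVERAL ISOGENY CLASSES PER FIELD.
[cite: DixonMortimer1996, §1.4 Ex. 1.4.1–1.4.2; §2.1] [cite: MoonenZarhin1995Duke, Thm. 2.4] [cite: Lang2002, XIII §4]

## References
* [DixonMortimer1996] J. D. Dixon, B. Mortimer, *Permutation Groups*, GTM 163, §1.4 (orbits and point stabilisers, Ex. 1.4.1–1.4.2), §2.1 (multiply transitive groups).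
* [MoonenZarhin1995Duke] B. Moonen, Yu. Zarhin, Hodge classes and Tate classes on simple abelian fourfolds, Duke Math. J. 77 (1995), Thm. 2.4.
* [Lang2002] S. Lang, *Algebra*, GTM 211, XIII §4 (linear independence, rank).
-/

noncomputable section

namespace Summit.HodgeConjecture.CorCM.MultiFieldWeil

open Finset

open scoped Classical

section Cells

variable {k : ℕ} {H : Finset (Equiv.Perm (Fin k))}

/-! ## §1 Pair fibres of a closed `2`-transitive set of permutations -/

/-- **Pair fibres, one inequality.**  `H ⊆ Sym(k)` closed under products and `2`-transitive: `#{σ ∈ H : σ p = x, σ p' = y} ≤ #{σ ∈ H : σ p₂ = x₂, σ p₂' = y₂}` for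
`p ≠ p'`, `p₂ ≠ p₂'`, `x ≠ y`, `x₂ ≠ y₂` — translate on both sides: `σ ↦ μ σ ρ` with `ρ (p₂, p₂') = (p, p')`, `μ (x, y) = (x₂, y₂)`.
[cite: DixonMortimer1996, §1.4 Ex. 1.4.1–1.4.2; §2.1] -/
theorem card_filter_pair_le (hmul : ∀ σ ∈ H, ∀ σ' ∈ H, σ * σ' ∈ H)
    (h2t : ∀ a a' b b' : Fin k, a ≠ a' → b ≠ b' → ∃ σ ∈ H, σ a = b ∧ σ a' = b')
    {p p' x y p₂ p₂' x₂ y₂ : Fin k} (hp : p ≠ p') (hp₂ : p₂ ≠ p₂') (hxy : x ≠ y) (hxy₂ : x₂ ≠ y₂) :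
    (H.filter fun σ => σ p = x ∧ σ p' = y).card ≤ (H.filter fun σ => σ p₂ = x₂ ∧ σ p₂' = y₂).card := by
  obtain ⟨ρ, hρ, hρ₁, hρ₂⟩ := h2t p₂ p₂' p p' hp₂ hp
  obtain ⟨μ, hμ, hμ₁, hμ₂⟩ := h2t x y x₂ y₂ hxy hxy₂
  refine Finset.card_le_card_of_injOn (fun σ => μ * σ * ρ) (fun σ hσ => ?_) (fun σ _ σ' _ h => ?_)
  · have hσ' := Finset.mem_filter.1 (Finset.mem_coe.1 hσ)
    refine Finset.mem_coe.2 (Finset.mem_filter.2 ⟨hmul _ (hmul _ hμ _ hσ'.1) _ hρ, ?_, ?_⟩)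
    · rw [Equiv.Perm.mul_apply, Equiv.Perm.mul_apply, hρ₁, hσ'.2.1, hμ₁]
    · rw [Equiv.Perm.mul_apply, Equiv.Perm.mul_apply, hρ₂, hσ'.2.2, hμ₂]
  · exact mul_left_cancel (mul_right_cancel h)

/-- **Pair fibres are uniform.**  `H ⊆ Sym(k)` closed under products and `2`-transitive: all the sets `{σ ∈ H : σ p = x, σ p' = y}` (`p ≠ p'`, `x ≠ y`) have the same
size. [cite: DixonMortimer1996, §1.4 Ex. 1.4.1–1.4.2; §2.1] -/
theorem card_filter_pair_eq (hmul : ∀ σ ∈ H, ∀ σ' ∈ H, σ * σ' ∈ H)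
    (h2t : ∀ a a' b b' : Fin k, a ≠ a' → b ≠ b' → ∃ σ ∈ H, σ a = b ∧ σ a' = b')
    {p p' x y p₂ p₂' x₂ y₂ : Fin k} (hp : p ≠ p') (hp₂ : p₂ ≠ p₂') (hxy : x ≠ y) (hxy₂ : x₂ ≠ y₂) :
    (H.filter fun σ => σ p = x ∧ σ p' = y).card = (H.filter fun σ => σ p₂ = x₂ ∧ σ p₂' = y₂).card :=
  le_antisymm (card_filter_pair_le hmul h2t hp hp₂ hxy hxy₂) (card_filter_pair_le hmul h2t hp₂ hp hxy₂ hxy)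

/-- **Pair fibres are non-empty.** [cite: DixonMortimer1996, §2.1] -/
theorem card_filter_pair_pos (h2t : ∀ a a' b b' : Fin k, a ≠ a' → b ≠ b' → ∃ σ ∈ H, σ a = b ∧ σ a' = b')
    {p p' x y : Fin k} (hp : p ≠ p') (hxy : x ≠ y) : 0 < (H.filter fun σ => σ p = x ∧ σ p' = y).card := by
  obtain ⟨σ, hσ, h₁, h₂⟩ := h2t p p' x y hp hxy
  exact Finset.card_pos.2 ⟨σ, Finset.mem_filter.2 ⟨hσ, h₁, h₂⟩⟩

/-- **Orbit sums through a point stabiliser coset.**  `H ⊆ Sym(k)` closed under products and `2`-transitive, `a ≠ b`: summing `g(σ a)` over `{σ ∈ H : σ b = q₀}` gives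
`N · Σ_{y ≠ q₀} g(y)`, `N` the common size of the pair fibres (the values `σ a` avoid `q₀ = σ b` and hit every other letter `N` times).
[cite: DixonMortimer1996, §1.4 Ex. 1.4.1–1.4.2; §2.1] -/
theorem sum_filter_apply_eq_of_twoTransitive (hmul : ∀ σ ∈ H, ∀ σ' ∈ H, σ * σ' ∈ H)
    (h2t : ∀ a a' b b' : Fin k, a ≠ a' → b ≠ b' → ∃ σ ∈ H, σ a = b ∧ σ a' = b')
    {a b : Fin k} (hab : a ≠ b) (q₀ : Fin k) {p p' x y : Fin k} (hp : p ≠ p') (hxy : x ≠ y) (g : Fin k → ℤ) :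
    (∑ σ ∈ H.filter (fun σ => σ b = q₀), g (σ a)) =
      ((H.filter fun σ => σ p = x ∧ σ p' = y).card : ℤ) * ∑ y' ∈ Finset.univ.erase q₀, g y' := by
  rw [show (∑ σ ∈ H.filter (fun σ => σ b = q₀), g (σ a)) =
      ∑ j : Fin k, ∑ σ ∈ (H.filter (fun σ => σ b = q₀)).filter (fun σ => σ a = j), g j from
    (Finset.sum_fiberwise' (H.filter fun σ => σ b = q₀) (fun σ => σ a) g).symm]
  rw [Finset.mul_sum, ← Finset.add_sum_erase _ _ (Finset.mem_univ q₀)]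
  have hempty : ((H.filter fun σ => σ b = q₀).filter fun σ => σ a = q₀) = ∅ := by
    refine Finset.filter_eq_empty_iff.2 fun σ hσ h => hab ?_
    exact σ.injective (h.trans (Finset.mem_filter.1 hσ).2.symm)
  rw [hempty, Finset.sum_empty, zero_add]
  refine Finset.sum_congr rfl fun j hj => ?_
  have hc : ((H.filter fun σ => σ b = q₀).filter fun σ => σ a = j).card = (H.filter fun σ => σ p = x ∧ σ p' = y).card := by
    rw [Finset.filter_filter]
    exact card_filter_pair_eq hmul h2t hab.symm hp (Finset.ne_of_mem_erase hj).symm hxy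
  rw [Finset.sum_const, nsmul_eq_mul, hc]

/-- The signed sum of a constant through a set, over the letters `≠ q₀`: `Σ_{y ≠ q₀} ±_{y ∈ Q} t = (2·|Q ∖ {q₀}| − (k − 1))·t`. [folklore] -/
theorem sum_erase_ite_mem (q₀ : Fin k) (Q : Finset (Fin k)) (t : ℤ) :
    (∑ y ∈ Finset.univ.erase q₀, (if y ∈ Q then t else -t)) = (2 * ((Q.erase q₀).card : ℤ) - ((k : ℤ) - 1)) * t := by
  rw [Finset.sum_ite]
  have hA : ((Finset.univ.erase q₀).filter fun y => y ∈ Q) = Q.erase q₀ := by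
    ext y; simp only [Finset.mem_filter, Finset.mem_erase, Finset.mem_univ, and_true]
  have hB : (((Finset.univ.erase q₀).filter fun y => ¬ y ∈ Q).card : ℤ) = ((k : ℤ) - 1) - (Q.erase q₀).card := by
    have h := Finset.card_filter_add_card_filter_not (s := Finset.univ.erase q₀) (fun y => y ∈ Q)
    rw [hA, Finset.card_erase_of_mem (Finset.mem_univ q₀), Finset.card_univ, Fintype.card_fin] at h
    have hk : 1 ≤ k := q₀.pos
    have h' : (((Finset.univ.erase q₀).filter fun y => ¬ y ∈ Q).card : ℤ) + (Q.erase q₀).card = ((k - 1 : ℕ) : ℤ) := by exact_mod_cast (by omega)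
    rw [Nat.cast_sub hk, Nat.cast_one] at h'
    linarith
  rw [Finset.sum_const, Finset.sum_const, nsmul_eq_mul, nsmul_eq_mul, hA, hB]
  ring

/-! ## §2 The cell identity -/

/-- **THE CELL IDENTITY.**  `H ⊆ Sym(k)` closed under products and `2`-transitive; position sets `Q_i` and functions `u_i` (`i ∈ ι`); if the total signed sum
`Σ_i Σ_a ±_{σ a ∈ Q_i} u_i(a)` is the same for every `σ ∈ H`, then for every letter `q₀` the quantity `Σ_i (k·[q₀ ∈ Q_i] − |Q_i|)·u_i(b)` does not depend on `b`
(sum the equations over `{σ ∈ H : σ b = q₀}` with §1: the letter `b` contributes through `[q₀ ∈ Q_i]`, every other letter through the uniform pair fibres).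
[cite: DixonMortimer1996, §1.4 Ex. 1.4.1–1.4.2; §2.1] [cite: MoonenZarhin1995Duke, Thm. 2.4] -/
theorem sum_cells_mul_eq_of_twoTransitive {ι : Type} [Fintype ι] (hmul : ∀ σ ∈ H, ∀ σ' ∈ H, σ * σ' ∈ H)
    (h2t : ∀ a a' b b' : Fin k, a ≠ a' → b ≠ b' → ∃ σ ∈ H, σ a = b ∧ σ a' = b')
    (Q : ι → Finset (Fin k)) (u : ι → Fin k → ℤ) {w : ℤ}
    (h : ∀ σ ∈ H, (∑ i, ∑ a : Fin k, (if σ a ∈ Q i then u i a else -u i a)) = w) (q₀ b b' : Fin k) :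
    (∑ i, ((k : ℤ) * (if q₀ ∈ Q i then 1 else 0) - (Q i).card) * u i b) =
      ∑ i, ((k : ℤ) * (if q₀ ∈ Q i then 1 else 0) - (Q i).card) * u i b' := by
  by_cases hbb : b = b'
  · rw [hbb]
  -- the reference pair fibre and its size `N > 0`
  set N : ℤ := ((H.filter fun σ => σ b = b ∧ σ b' = b').card : ℤ) with hN
  have hN0 : N ≠ 0 := by
    have := card_filter_pair_pos h2t (x := b) (y := b') hbb hbb
    rw [hN]; exact_mod_cast this.ne'
  set ε : ι → ℤ := fun i => if q₀ ∈ Q i then 1 else 0 with hε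
  have hεite : ∀ (i : ι) (t : ℤ), (if q₀ ∈ Q i then t else -t) = (2 * ε i - 1) * t := fun i t => by
    simp only [hε]; split_ifs <;> ring
  have hεcard : ∀ i : ι, (((Q i).erase q₀).card : ℤ) = ((Q i).card : ℤ) - ε i := fun i => by
    simp only [hε]
    split_ifs with hq
    · rw [Finset.card_erase_of_mem hq, Nat.cast_sub (Finset.card_pos.2 ⟨q₀, hq⟩), Nat.cast_one]
    · rw [Finset.erase_eq_of_notMem hq, sub_zero]
  -- the summed equation over `{σ ∈ H : σ c = q₀}`, for a letter `c` with a letter `a₁ ≠ c`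
  have key : ∀ c a₁ : Fin k, a₁ ≠ c →
      (∑ i, ((2 * (((Q i).card : ℤ) - ε i) - ((k : ℤ) - 1)) * ((∑ a, u i a) - u i c) + ((k : ℤ) - 1) * ((2 * ε i - 1) * u i c))) = ((k : ℤ) - 1) * w := by
    intro c a₁ hac
    set S : Finset (Equiv.Perm (Fin k)) := H.filter fun σ => σ c = q₀ with hS
    have hSH : ∀ σ ∈ S, σ ∈ H := fun σ hσ => (Finset.mem_filter.1 hσ).1
    -- `|S| = N (k - 1)`
    have hScard : ((S.card : ℕ) : ℤ) = N * ((k : ℤ) - 1) := by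
      have h1 := sum_filter_apply_eq_of_twoTransitive hmul h2t hac q₀ hbb hbb (fun _ => (1 : ℤ))
      rw [Finset.sum_const, nsmul_eq_mul, mul_one, Finset.sum_const, nsmul_eq_mul, mul_one, Finset.card_erase_of_mem (Finset.mem_univ q₀),
        Finset.card_univ, Fintype.card_fin, Nat.cast_sub q₀.pos, Nat.cast_one] at h1
      rw [← hN] at h1
      exact h1
    -- the equations summed over `S`
    have hsum : (∑ σ ∈ S, ∑ i, ∑ a : Fin k, (if σ a ∈ Q i then u i a else -u i a)) = (S.card : ℤ) * w := by
      rw [Finset.sum_congr rfl fun σ hσ => h σ (hSH σ hσ), Finset.sum_const, nsmul_eq_mul]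
    rw [Finset.sum_comm] at hsum
    -- slot by slot
    have hslot : ∀ i : ι, (∑ σ ∈ S, ∑ a : Fin k, (if σ a ∈ Q i then u i a else -u i a)) =
        N * ((2 * (((Q i).card : ℤ) - ε i) - ((k : ℤ) - 1)) * ((∑ a, u i a) - u i c)) + N * (((k : ℤ) - 1) * ((2 * ε i - 1) * u i c)) := by
      intro i
      rw [Finset.sum_comm, ← Finset.add_sum_erase _ _ (Finset.mem_univ c), add_comm]
      congr 1
      · -- the letters `a ≠ c`
        have hterm : ∀ a ∈ Finset.univ.erase c, (∑ σ ∈ S, (if σ a ∈ Q i then u i a else -u i a)) =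
            N * ((2 * (((Q i).card : ℤ) - ε i) - ((k : ℤ) - 1)) * u i a) := by
          intro a ha
          rw [sum_filter_apply_eq_of_twoTransitive hmul h2t (Finset.ne_of_mem_erase ha) q₀ hbb hbb (fun y => if y ∈ Q i then u i a else -u i a),
            sum_erase_ite_mem, hεcard i]
        rw [Finset.sum_congr rfl hterm, ← Finset.mul_sum, ← Finset.mul_sum, Finset.sum_erase_eq_sub (Finset.mem_univ c)]
      · -- the letter `c` itself: `σ c = q₀` throughout
        rw [Finset.sum_congr rfl fun σ hσ => by rw [(Finset.mem_filter.1 hσ).2], Finset.sum_const, nsmul_eq_mul, hScard, hεite]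
        ring
    rw [Finset.sum_congr rfl fun i _ => hslot i, hScard] at hsum
    -- cancel `N`
    have hfac : N * (∑ i, ((2 * (((Q i).card : ℤ) - ε i) - ((k : ℤ) - 1)) * ((∑ a, u i a) - u i c) + ((k : ℤ) - 1) * ((2 * ε i - 1) * u i c))) =
        N * (((k : ℤ) - 1) * w) := by
      rw [Finset.mul_sum]
      calc _ = ∑ i, (N * ((2 * (((Q i).card : ℤ) - ε i) - ((k : ℤ) - 1)) * ((∑ a, u i a) - u i c)) + N * (((k : ℤ) - 1) * ((2 * ε i - 1) * u i c))) :=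
            Finset.sum_congr rfl fun i _ => by ring
        _ = _ := by rw [hsum]; ring
    exact mul_left_cancel₀ hN0 hfac
  -- compare the letters `b` and `b'`
  have hb := key b b' (Ne.symm hbb)
  have hb' := key b' b hbb
  have hdiff : (∑ i, 2 * (((k : ℤ) * ε i - (Q i).card) * u i b)) = ∑ i, 2 * (((k : ℤ) * ε i - (Q i).card) * u i b') := by
    have h1 : (∑ i, ((2 * (((Q i).card : ℤ) - ε i) - ((k : ℤ) - 1)) * ((∑ a, u i a) - u i b) + ((k : ℤ) - 1) * ((2 * ε i - 1) * u i b))) -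
        ∑ i, ((2 * (((Q i).card : ℤ) - ε i) - ((k : ℤ) - 1)) * ((∑ a, u i a) - u i b') + ((k : ℤ) - 1) * ((2 * ε i - 1) * u i b')) = 0 := by
      rw [hb, hb', sub_self]
    rw [← Finset.sum_sub_distrib] at h1
    rw [← sub_eq_zero, ← Finset.sum_sub_distrib, ← h1]
    exact Finset.sum_congr rfl fun i _ => by ring
  rw [← Finset.mul_sum, ← Finset.mul_sum] at hdiff
  have h2 := mul_left_cancel₀ (two_ne_zero : (2 : ℤ) ≠ 0) hdiff
  simpa only [hε] using h2

/-! ## §3 Separation from linear independence of the centred indicators -/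

/-- **SEPARATION FROM THE CELLS.**  If for every letter `q₀` the quantity `Σ_i (k·[q₀ ∈ Q_i] − |Q_i|)·u_i(b)` does not depend on `b`, and the centred indicators
`q ↦ k·[q ∈ Q_i] − |Q_i|` (`i ∈ ι`) are linearly independent over `ℚ`, then every `u_i` is constant (apply the independence to the coefficients `u_i(b) − u_i(b')`).
[cite: Lang2002, XIII §4] -/
theorem const_of_cells_of_linearIndependent {ι : Type} [Fintype ι] (Q : ι → Finset (Fin k)) (u : ι → Fin k → ℤ)
    (hcell : ∀ q₀ b b' : Fin k, (∑ i, ((k : ℤ) * (if q₀ ∈ Q i then 1 else 0) - (Q i).card) * u i b) =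
      ∑ i, ((k : ℤ) * (if q₀ ∈ Q i then 1 else 0) - (Q i).card) * u i b')
    (hli : LinearIndependent ℚ fun i : ι => fun q : Fin k => ((k : ℚ) * (if q ∈ Q i then 1 else 0) - (Q i).card))
    (i : ι) (b b' : Fin k) : u i b = u i b' := by
  have hg := Fintype.linearIndependent_iff.1 hli (fun j => ((u j b - u j b' : ℤ) : ℚ)) ?_ i
  · have : (u i b - u i b' : ℤ) = 0 := by exact_mod_cast hg
    exact sub_eq_zero.1 this
  · funext q
    rw [Finset.sum_apply, Pi.zero_apply]
    simp only [Pi.smul_apply, smul_eq_mul]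
    have hq : (∑ j, ((k : ℤ) * (if q ∈ Q j then 1 else 0) - (Q j).card) * (u j b - u j b')) = 0 := by
      rw [Finset.sum_congr rfl fun j _ => mul_sub _ _ _, Finset.sum_sub_distrib, sub_eq_zero]
      exact hcell q b b'
    have hq' := congrArg (fun z : ℤ => (z : ℚ)) hq
    simp only [Int.cast_sum, Int.cast_mul, Int.cast_sub, Int.cast_natCast, Int.cast_ite, Int.cast_one, Int.cast_zero] at hq'
    calc _ = ∑ j, ((k : ℚ) * (if q ∈ Q j then 1 else 0) - (Q j).card) * ((u j b : ℚ) - (u j b' : ℚ)) :=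
          Finset.sum_congr rfl fun j _ => by push_cast; ring
      _ = 0 := hq'

/-- **UNIT SEPARATION.**  `H ⊆ Sym(k)` closed under products and `2`-TRANSITIVE; position sets `Q_i` with LINEARLY INDEPENDENT centred indicators `k·𝟙_{Q_i} − |Q_i|·𝟙`
(`i ∈ ι`, over `ℚ`); if `Σ_i Σ_a ±_{σ a ∈ Q_i} u_i(a)` is the same for every `σ ∈ H`, every `u_i` is constant. [cite: DixonMortimer1996, §1.4 Ex. 1.4.1–1.4.2; §2.1]
[cite: MoonenZarhin1995Duke, Thm. 2.4] [cite: Lang2002, XIII §4] -/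
theorem const_of_signed_unit_of_linearIndependent {ι : Type} [Fintype ι] (hmul : ∀ σ ∈ H, ∀ σ' ∈ H, σ * σ' ∈ H)
    (h2t : ∀ a a' b b' : Fin k, a ≠ a' → b ≠ b' → ∃ σ ∈ H, σ a = b ∧ σ a' = b')
    (Q : ι → Finset (Fin k)) (u : ι → Fin k → ℤ) {w : ℤ}
    (h : ∀ σ ∈ H, (∑ i, ∑ a : Fin k, (if σ a ∈ Q i then u i a else -u i a)) = w)
    (hli : LinearIndependent ℚ fun i : ι => fun q : Fin k => ((k : ℚ) * (if q ∈ Q i then 1 else 0) - (Q i).card))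
    (i : ι) (b b' : Fin k) : u i b = u i b' :=
  const_of_cells_of_linearIndependent Q u (fun q₀ c c' => sum_cells_mul_eq_of_twoTransitive hmul h2t Q u h q₀ c c') hli i b b'

/-! ## §4 One set; two sets -/

/-- **ONE PROPER NON-EMPTY POSITION SET OF ANY SIZE SEPARATES UNDER A `2`-TRANSITIVE IMAGE.**  (The centred indicator of a proper non-empty set is non-zero.)
[cite: DixonMortimer1996, §2.1] [cite: MoonenZarhin1995Duke, Thm. 2.4] -/
theorem const_of_signed_of_twoTransitive (hmul : ∀ σ ∈ H, ∀ σ' ∈ H, σ * σ' ∈ H)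
    (h2t : ∀ a a' b b' : Fin k, a ≠ a' → b ≠ b' → ∃ σ ∈ H, σ a = b ∧ σ a' = b')
    {Q : Finset (Fin k)} (hQ0 : Q.Nonempty) (hQk : Q.card < k) (u : Fin k → ℤ) {w : ℤ}
    (h : ∀ σ ∈ H, (∑ a : Fin k, (if σ a ∈ Q then u a else -u a)) = w) (b b' : Fin k) : u b = u b' := by
  refine const_of_signed_unit_of_linearIndependent (ι := Unit) hmul h2t (fun _ => Q) (fun _ => u) (w := w)
    (fun σ hσ => by rw [Fintype.sum_unique]; exact h σ hσ) ?_ () b b'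
  rw [linearIndependent_unique_iff]
  intro hz
  obtain ⟨q, hq⟩ := hQ0
  -- a letter outside `Q`
  obtain ⟨q', hq'⟩ : ∃ q', q' ∉ Q := by
    by_contra hno
    push Not at hno
    have : Finset.univ ⊆ Q := fun y _ => hno y
    have := Finset.card_le_card this
    rw [Finset.card_univ, Fintype.card_fin] at this
    omega
  have h1 := congrFun hz q
  have h2 := congrFun hz q'
  simp only [if_pos hq, if_neg hq', Pi.zero_apply] at h1 h2
  have : (k : ℚ) = 0 := by linarith
  have hk : (k : ℚ) ≠ 0 := by exact_mod_cast (show k ≠ 0 by omega)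
  exact hk this

/-- Two cells pin both coefficients (the case `∃ q₁ ∈ Q₁ ∖ Q₂`). [cite: Lang2002, XIII §4] -/
theorem eq_zero_of_cells_pair {Q₁ Q₂ : Finset (Fin k)} (h₁k : Q₁.card < k) (h₂0 : Q₂.Nonempty) (hnc : Q₂ ≠ Q₁ᶜ)
    {q₁ : Fin k} (hq₁ : q₁ ∈ Q₁) (hq₁' : q₁ ∉ Q₂) {g₁ g₂ : ℚ}
    (hE : ∀ q : Fin k, g₁ * ((k : ℚ) * (if q ∈ Q₁ then 1 else 0) - Q₁.card) + g₂ * ((k : ℚ) * (if q ∈ Q₂ then 1 else 0) - Q₂.card) = 0) :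
    g₁ = 0 ∧ g₂ = 0 := by
  have hkQ₁ : ((k : ℚ) - Q₁.card) ≠ 0 := sub_ne_zero.2 (by exact_mod_cast h₁k.ne')
  have hQ₂ : (Q₂.card : ℚ) ≠ 0 := by exact_mod_cast (Finset.card_pos.2 h₂0).ne'
  have hk0 : (k : ℚ) ≠ 0 := by exact_mod_cast (show k ≠ 0 by have := h₁k; omega)
  have E₁ := hE q₁
  simp only [if_pos hq₁, if_neg hq₁'] at E₁
  by_cases hi : ∃ q₃, q₃ ∈ Q₁ ∧ q₃ ∈ Q₂
  · obtain ⟨q₃, h₃, h₃'⟩ := hi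
    have E₃ := hE q₃
    simp only [if_pos h₃, if_pos h₃'] at E₃
    have hg₂ : g₂ * (k : ℚ) = 0 := by linear_combination E₃ - E₁
    have hg₂0 : g₂ = 0 := (mul_eq_zero.1 hg₂).resolve_right hk0
    rw [hg₂0] at E₁
    have hg₁ : g₁ * ((k : ℚ) - Q₁.card) = 0 := by linear_combination E₁
    exact ⟨(mul_eq_zero.1 hg₁).resolve_right hkQ₁, hg₂0⟩
  · by_cases ho : ∃ q₄, q₄ ∉ Q₁ ∧ q₄ ∉ Q₂
    · obtain ⟨q₄, h₄, h₄'⟩ := ho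
      have E₄ := hE q₄
      simp only [if_neg h₄, if_neg h₄'] at E₄
      have hg₁ : g₁ * (k : ℚ) = 0 := by linear_combination E₁ - E₄
      have hg₁0 : g₁ = 0 := (mul_eq_zero.1 hg₁).resolve_right hk0
      rw [hg₁0] at E₁
      have hg₂ : g₂ * (Q₂.card : ℚ) = 0 := by linear_combination -E₁
      exact ⟨hg₁0, (mul_eq_zero.1 hg₂).resolve_right hQ₂⟩
    · exfalso
      push Not at hi ho
      exact hnc (Finset.ext fun q => by
        rw [Finset.mem_compl]
        exact ⟨fun hq hq' => hi q hq' hq, fun hq => ho q hq⟩)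

/-- **TWO PROPER NON-EMPTY POSITION SETS `Q₂ ∉ {Q₁, Q₁ᶜ}` HAVE LINEARLY INDEPENDENT CENTRED INDICATORS** (index type with exactly two elements `i₁ ≠ i₂`).
[cite: Lang2002, XIII §4] -/
theorem linearIndependent_cells_of_two {ι : Type} [Fintype ι] (i₁ i₂ : ι) (h12 : i₁ ≠ i₂) (huniv : ∀ i, i = i₁ ∨ i = i₂)
    (Q : ι → Finset (Fin k)) (h0 : ∀ i, (Q i).Nonempty) (hk : ∀ i, (Q i).card < k) (hne : Q i₂ ≠ Q i₁) (hnc : Q i₂ ≠ (Q i₁)ᶜ) :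
    LinearIndependent ℚ fun i : ι => fun q : Fin k => ((k : ℚ) * (if q ∈ Q i then 1 else 0) - (Q i).card) := by
  rw [Fintype.linearIndependent_iff]
  intro g hg
  have hu : (Finset.univ : Finset ι) = {i₁, i₂} := by
    ext i; simp only [Finset.mem_univ, Finset.mem_insert, Finset.mem_singleton, true_iff]; exact huniv i
  have hE : ∀ q : Fin k, g i₁ * ((k : ℚ) * (if q ∈ Q i₁ then 1 else 0) - (Q i₁).card) + g i₂ * ((k : ℚ) * (if q ∈ Q i₂ then 1 else 0) - (Q i₂).card) = 0 := by
    intro q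
    have := congrFun hg q
    rw [Finset.sum_apply, Pi.zero_apply, hu, Finset.sum_pair h12] at this
    simpa only [Pi.smul_apply, smul_eq_mul] using this
  have hboth : g i₁ = 0 ∧ g i₂ = 0 := by
    by_cases h₁ : ∃ q₁, q₁ ∈ Q i₁ ∧ q₁ ∉ Q i₂
    · obtain ⟨q₁, hq₁, hq₁'⟩ := h₁
      exact eq_zero_of_cells_pair (hk i₁) (h0 i₂) hnc hq₁ hq₁' hE
    · have h₂ : ∃ q₂, q₂ ∈ Q i₂ ∧ q₂ ∉ Q i₁ := by
        by_contra h₂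
        push Not at h₁ h₂
        exact hne (Finset.Subset.antisymm (fun q hq => h₂ q hq) fun q hq => h₁ q hq)
      obtain ⟨q₂, hq₂, hq₂'⟩ := h₂
      have hnc' : Q i₁ ≠ (Q i₂)ᶜ := fun h => hnc (by rw [h, compl_compl])
      have := eq_zero_of_cells_pair (hk i₂) (h0 i₁) hnc' hq₂ hq₂' (g₁ := g i₂) (g₂ := g i₁) (fun q => by rw [add_comm]; exact hE q)
      exact ⟨this.2, this.1⟩
  intro i
  rcases huniv i with rfl | rfl
  exacts [hboth.1, hboth.2]

/-- **THE TWIN UNIT WITH ARBITRARY POSITION SETS.**  `H ⊆ Sym(k)` closed under products and `2`-TRANSITIVE; two proper non-empty position sets `Q₂ ∉ {Q₁, Q₁ᶜ}`; if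
`Σ_a ±_{σ a ∈ Q₁} u₁(a) + Σ_a ±_{σ a ∈ Q₂} u₂(a)` is the same for every `σ ∈ H`, then `u₁` and `u₂` are constant.  (Gen 37's `const_of_signed_twin` is the case of two
distinct singletons, `k ≥ 3`.) [cite: DixonMortimer1996, §2.1] [cite: MoonenZarhin1995Duke, Thm. 2.4] [cite: Lang2002, XIII §4] -/
theorem const_of_signed_pair_of_twoTransitive (hmul : ∀ σ ∈ H, ∀ σ' ∈ H, σ * σ' ∈ H)
    (h2t : ∀ a a' b b' : Fin k, a ≠ a' → b ≠ b' → ∃ σ ∈ H, σ a = b ∧ σ a' = b')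
    {Q₁ Q₂ : Finset (Fin k)} (h₁0 : Q₁.Nonempty) (h₁k : Q₁.card < k) (h₂0 : Q₂.Nonempty) (h₂k : Q₂.card < k) (hne : Q₂ ≠ Q₁) (hnc : Q₂ ≠ Q₁ᶜ)
    (u₁ u₂ : Fin k → ℤ) {w : ℤ}
    (h : ∀ σ ∈ H, (∑ a : Fin k, (if σ a ∈ Q₁ then u₁ a else -u₁ a)) + (∑ a : Fin k, (if σ a ∈ Q₂ then u₂ a else -u₂ a)) = w) :
    (∀ b b', u₁ b = u₁ b') ∧ (∀ b b', u₂ b = u₂ b') := by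
  have hc := const_of_signed_unit_of_linearIndependent (ι := Bool) hmul h2t (fun i => bif i then Q₁ else Q₂) (fun i => bif i then u₁ else u₂) (w := w)
    (fun σ hσ => by rw [Fintype.sum_bool]; simpa only [cond_true, cond_false] using h σ hσ)
    (linearIndependent_cells_of_two true false (by decide) (fun i => by cases i <;> simp) _
      (fun i => by cases i <;> assumption) (fun i => by cases i <;> assumption) (by simpa only [cond_true, cond_false] using hne)
      (by simpa only [cond_true, cond_false] using hnc))
  exact ⟨fun b b' => by simpa only [cond_true] using hc true b b', fun b b' => by simpa only [cond_false] using hc false b b'⟩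

end Cells

end Summit.HodgeConjecture.CorCM.MultiFieldWeil

end
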